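/-
Copyright (c) 2026 the pub-hodgecm-mathlib formalisation cell (harness21).  Prover seat hodgecm-mathlib-K2E1-p02 (g6), Track B ∕ K2-LIT (build stream 29),
h413 = `stmt-HodgeConjecture-24833`, line `K2_E1_TraceFormulaBeta`, campaign «EIS-R7-BL» road BL-SPH-3 (Bernstein–Lapid soft continuation of the spherical Borel Eisenstein series
of `U(2,1)`), file «BL-R1₃» (part 1 of 3) = the `N = 3` twin of K2E1-p08 (g6)'s ★ p858699 `K2E1BLHeightCosetsU2`; dealer K2E1-plan (g5) DEAL 2026-09-04T09:08:04Z.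
-/
import Literature.NumberTheory.Automorphic.UnitaryGroupTruncatedKernelClassBorelCount        -- ★ `borelHeight_out_mk_mul` (`N = 3`)
import Literature.NumberTheory.Automorphic.UnitaryGroupBorelHeightBigCell                    -- ★ THE SIEGEL PROPERTY `borelHeight_mul_borelHeight_le_one_of_not_mem_arithmeticBorel` (`U(J₃)`: `H(γx)·H(x) ≤ 1` off `B(F)`)
import Literature.NumberTheory.Automorphic.UnitaryGroupTruncationFiniteSum                   -- ★ `finite_setOf_lt_borelHeight` (`N = 3`, Northcott), ★ `borelHeight_rational_mul_le`
import Summits.HodgeConjecture.HodgeConjecture.Theorems.K2E1HeightFunctionU3                  -- ★ (K2E1-p09 g2) `borelHeight_ray_mul` (+ ★ `exists_torusInBorel_ray`: the ray `a(r) = diag(z(r), 1, z(r)⁻¹)`)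
import Literature.NumberTheory.Automorphic.UnitaryGroupTorusSiegelIntegral                   -- ★ `borelHeight_pos`
import HarnessLib

/-!
# h413 ∕ Track B «K2-LIT», road BL-SPH-3 — helper `K2E1BLHeightCosetsU3` («BL-R1₃», part 1): THE SIEGEL PROPERTY `H(γx)·H(x) ≤ 1`, THE ATTAINED AND `G(F)`-INVARIANT
# SUPREMUM `w₁ = sup_γ H(γ ·)`, AND `inf H = 0`, FOR `U(J₃) = U(2,1)` OVER ANY QUADRATIC `E ∕ F` — the `N = 3` twin of ★ p858699 `K2E1BLHeightCosetsU2`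

Cell `pub/hodgecm-mathlib`, crux H413 = `stmt-HodgeConjecture-24833`, route of record `HCCMUnconditional`; chair K2-lead (g1), dealer K2E1-plan (g5) (DEAL 09:08:04Z «R1₃ = twins of
★ p858699 ∕ p858727 ∕ p858750 on `quasiSplit L⁺ L c 3`, names mirrored»); spec of record = (ζ′) WIRING «EIS-R7-BL-SPH-2» `7d1cceb628a30de8` §5 R1 read at `N = 3` (ROAD CARD «BL-SPH-3»
931c49d9a911bba9 §2: clone discipline `2 ↦ 3`), RULING «Z := B(F)∖G(𝔸)» 08:57:54Z (R1 is indexed by `B(F)∖G(F)` — consistent).  THEOREMS ONLY (no `def`, no `instance`, no `notation`,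
no named-fact hypothesis, no `sorry`); lane `--kind proof --supports stmt-HodgeConjecture-24833 --as helper` (count-neutral).  EVERYTHING ON MOK'S DATUM `quasiSplit F E c 3`
(`G(𝔸) = U(J₃)(𝔸_F)`, `G(F) = arithmeticSubgroup`, `B(F) = arithmeticBorel`, `H = borelHeight`, cosets `B(F)∖G(F) = Quotient (QuotientGroup.rightRel (arithmeticBorel F E c 3))`
with representatives `q̃ = q.out` — the index of ★ `truncation` ∕ ★ `eisensteinSeriesU`), LEFT action `H(γ · x)` as in print; every quadratic `E ∕ F` (no CM hypothesis).  The proofs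
are ★ p858699's token for token with the `N = 3` bricks ★ `borelHeight_mul_borelHeight_le_one_of_not_mem_arithmeticBorel` (Siegel property of `U(J₃)`), ★ `borelHeight_out_mk_mul`,
★ `finite_setOf_lt_borelHeight`, and the RAY `a(r) = diag(z(r), 1, z(r)⁻¹)` (★ `borelHeight_ray_mul`) in place of `d(z(r), z(r)⁻¹)`.

* §1 **CONSEQUENCES OF THE SIEGEL PROPERTY** (B–L «`p_c` is injective for `c > 1`», [MW] I.2.2): `borelHeight_mul_le_of_inv_le` (`c⁻¹ ≤ H(x)` ⟹ `H(γ x) ≤ c` off `B(F)`),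
  `mk_eq_of_lt_borelHeight` ∕ `setOf_lt_borelHeight_subset_singleton` ∕ `ncard_setOf_lt_borelHeight_le_one` (above height `c⁻¹` only the trivial coset has `H(q̃ x) > c`).
* §2 **`w₁` IS FINITE, ATTAINED AND `G(F)`-INVARIANT**: `bddAbove_range_borelHeight_mul`, **`exists_forall_borelHeight_mul_le`**, `borelHeight_mul_le_ciSup` ∕ `borelHeight_le_ciSup` ∕
  `exists_borelHeight_mul_eq_ciSup` ∕ `ciSup_borelHeight_mul_pos`, `ciSup_borelHeight_mul_mul` (`w₁` descends to the automorphic quotient), `ncard_setOf_lt_borelHeight_mul_le` (the coset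
  count is `G(F)`-invariant), `borelHeight_mul_le_matHeightBound_mul` (`H(δ y) ≤ H_mat(y⁻¹) · H(δ)`).
* §3 **`inf H = 0`**: `exists_torus_posRealIdele_three` (the ray `a(r)` with its HEIGHT LAW `H(a(r) · g) = r^{[E:ℚ]} H(g)`), `exists_torus_borelHeight_lt` ∕ `exists_borelHeight_lt` (B–L Claim 2's
  «`H → 0`»).

HONEST LABEL.  Count-neutral helper of the BL-SPH-3 clone (consumers: P2a₃ `iota` ∕ `w₁`, K1₃-L², P6₃, and parts 2–3); closes no socket; HC_CM is proved only modulo the 7 printed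
citations (2 remaining named inputs: hLiu418 = `stmt-HodgeConjecture-24832`, h413 = `stmt-HodgeConjecture-24833`) until rung 0 closes.

## References
* [BernsteinLapid2019] J. Bernstein, E. Lapid, *On the meromorphic continuation of Eisenstein series*, J. Amer. Math. Soc. 37 (2024) (arXiv:1911.02342), §4
  (pp. 9–10: `p_c` finite-to-one ∕ surjective ∕ injective; `w₁`; Claim 2).
* [Godement1964] R. Godement, *Domaines fondamentaux des groupes arithmétiques*, Sém. Bourbaki 257 (1962∕63), §1.1 (the inequality `|⟨x,y⟩| ≤ h(x)h(y)`).
* [Borel1963] A. Borel, *Some finiteness properties of adele groups over number fields*, Publ. Math. IHÉS 16 (1963), §5.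
* [Garrett2018] P. Garrett, *Modern Analysis of Automorphic Forms by Example* (2018), §2.2–§2.3 (reduction theory via heights), §2.10, Cor. 3.3.3.
* [MoeglinWaldspurger1995] C. Mœglin, J.-L. Waldspurger, *Spectral Decomposition and Eisenstein Series* (1995), I.2.1–I.2.2.
* [Rogawski1990] J. D. Rogawski, *Automorphic Representations of Unitary Groups in Three Variables* (1990), §1.10, §2.2 (p. 13).
-/

set_option autoImplicit false
-- the mandated namespace repeats `HodgeConjecture.HodgeConjecture`, as in every `Theorems/*.lean` of this sub-problem
set_option linter.dupNamespace false

noncomputable section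

open NumberField IsDedekindDomain Set Matrix
open scoped NNReal Pointwise MatrixGroups

namespace Summit.HodgeConjecture.HodgeConjecture.Cruxes.H413.K2E1BLHeightCosetsU3

open Literature.NumberTheory.Automorphic Literature.NumberTheory.Automorphic.UnitaryGroup AdelicGroupData
open Summit.HodgeConjecture.HodgeConjecture.Cruxes.H413

section Generic

variable {F E : Type} [Field F] [NumberField F] [Field E] [NumberField E] [Algebra F E] {c : E ≃ₐ[F] E}

/-! ## §1 Consequences of the Siegel property ★ `H(γ x) · H(x) ≤ 1` off `B(F)`: above height `c⁻¹` only the trivial coset is cut off -/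

/-- **Above height `c⁻¹` every non-trivial translate has height `≤ c`**: if `c > 0`, `c⁻¹ ≤ H(x)` and `γ ∈ G(F) ∖ B(F)` then `H(γ x) ≤ c` (the Siegel property ★
`borelHeight_mul_borelHeight_le_one_of_not_mem_arithmeticBorel`: `H(γ x) · H(x) ≤ 1`). [cite: BernsteinLapid2019, §4 (p. 9)] [cite: Garrett2018, §2.3] -/
theorem borelHeight_mul_le_of_inv_le {c₀ : ℝ≥0} (hc : 0 < c₀) {x : (quasiSplit F E c 3).Adelic} (hx : c₀⁻¹ ≤ borelHeight x)
    {γ : (quasiSplit F E c 3).arithmeticSubgroup} (hγ : γ ∉ arithmeticBorel F E c 3) :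
    borelHeight ((γ : (quasiSplit F E c 3).Adelic) * x) ≤ c₀ := by
  have h := borelHeight_mul_borelHeight_le_one_of_not_mem_arithmeticBorel hγ x
  have hx0 : 0 < borelHeight x := lt_of_lt_of_le (inv_pos.2 hc) hx
  calc borelHeight ((γ : (quasiSplit F E c 3).Adelic) * x)
      = borelHeight ((γ : (quasiSplit F E c 3).Adelic) * x) * borelHeight x * (borelHeight x)⁻¹ := by
        rw [mul_inv_cancel_right₀ hx0.ne']
    _ ≤ 1 * (borelHeight x)⁻¹ := by gcongr
    _ ≤ c₀ := by rw [one_mul]; exact inv_le_of_inv_le₀ hc hx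

/-- **Above height `c⁻¹` only the trivial coset is cut off**: if `c⁻¹ ≤ H(x)` and `c < H(q̃ x)` for the representative `q̃ = q.out` of a coset
`q ∈ B(F)∖G(F)`, then `q` is the coset of `1`. [cite: BernsteinLapid2019, §4 (p. 9)] -/
theorem mk_eq_of_lt_borelHeight {c₀ : ℝ≥0} (hc : 0 < c₀) {x : (quasiSplit F E c 3).Adelic} (hx : c₀⁻¹ ≤ borelHeight x)
    {q : Quotient (QuotientGroup.rightRel (arithmeticBorel F E c 3))}
    (hq : c₀ < borelHeight (((q.out : (quasiSplit F E c 3).arithmeticSubgroup) : (quasiSplit F E c 3).Adelic) * x)) :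
    q = Quotient.mk (QuotientGroup.rightRel (arithmeticBorel F E c 3)) 1 := by
  by_contra hne
  have hout : q.out ∉ arithmeticBorel F E c 3 := by
    intro hB
    apply hne
    rw [← Quotient.out_eq q]
    exact Quotient.sound (QuotientGroup.rightRel_apply.2 (by rw [one_mul]; exact inv_mem hB))
  exact absurd hq (not_lt.2 (borelHeight_mul_le_of_inv_le hc hx hout))

/-- The same as an inclusion of sets: above height `c⁻¹`, `{q ∣ c < H(q̃ x)} ⊆ {B(F)·1}`. [cite: BernsteinLapid2019, §4 (p. 9)] -/
theorem setOf_lt_borelHeight_subset_singleton {c₀ : ℝ≥0} (hc : 0 < c₀) {x : (quasiSplit F E c 3).Adelic} (hx : c₀⁻¹ ≤ borelHeight x) :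
    {q : Quotient (QuotientGroup.rightRel (arithmeticBorel F E c 3)) |
        c₀ < borelHeight (((q.out : (quasiSplit F E c 3).arithmeticSubgroup) : (quasiSplit F E c 3).Adelic) * x)} ⊆
      {Quotient.mk (QuotientGroup.rightRel (arithmeticBorel F E c 3)) 1} :=
  fun _ hq => mk_eq_of_lt_borelHeight hc hx hq

/-- The same as a count: above height `c⁻¹`, `#{q ∈ B(F)∖G(F) ∣ c < H(q̃ x)} ≤ 1`. [cite: BernsteinLapid2019, §4 (p. 9)] -/
theorem ncard_setOf_lt_borelHeight_le_one {c₀ : ℝ≥0} (hc : 0 < c₀) {x : (quasiSplit F E c 3).Adelic} (hx : c₀⁻¹ ≤ borelHeight x) :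
    {q : Quotient (QuotientGroup.rightRel (arithmeticBorel F E c 3)) |
        c₀ < borelHeight (((q.out : (quasiSplit F E c 3).arithmeticSubgroup) : (quasiSplit F E c 3).Adelic) * x)}.ncard ≤ 1 :=
  (Set.ncard_le_ncard (setOf_lt_borelHeight_subset_singleton hc hx) (Set.finite_singleton _)).trans_eq (Set.ncard_singleton _)

/-! ## §2 `w₁(x) = sup_γ H(γ x)` is finite, attained and `G(F)`-invariant; the coset count is `G(F)`-invariant -/

/-- **The heights `H(γ x)`, `γ ∈ G(F)`, are bounded** (by `H_mat(x⁻¹)`, ★ `borelHeight_rational_mul_le`). [cite: Garrett2018, Cor. 3.3.3 (PDF p. 163)] -/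
theorem bddAbove_range_borelHeight_mul (x : (quasiSplit F E c 3).Adelic) :
    BddAbove (Set.range fun γ : (quasiSplit F E c 3).arithmeticSubgroup => borelHeight ((γ : (quasiSplit F E c 3).Adelic) * x)) := by
  refine ⟨matHeightBound E (((adelicVal F E c 3 _ x)⁻¹ : GL (Fin 3) (AdeleRing (𝓞 E) E)) : Matrix (Fin 3) (Fin 3) (AdeleRing (𝓞 E) E)), ?_⟩
  rintro _ ⟨γ, rfl⟩
  exact borelHeight_rational_mul_le γ x

/-- The height at the representative of the trivial coset: `H((B(F)·1).out · x) = H(x)`. [cite: Garrett2018, §2.10 (PDF p. 119)] -/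
theorem borelHeight_out_one_mul (x : (quasiSplit F E c 3).Adelic) :
    borelHeight ((((Quotient.mk (QuotientGroup.rightRel (arithmeticBorel F E c 3)) 1).out :
        (quasiSplit F E c 3).arithmeticSubgroup) : (quasiSplit F E c 3).Adelic) * x) = borelHeight x := by
  rw [borelHeight_out_mk_mul, OneMemClass.coe_one, one_mul]

/-- **`w₁` IS ATTAINED**: for every `x ∈ G(𝔸)` some `γ₀ ∈ G(F)` maximises `γ ↦ H(γ x)` (B–L's `w₁(x) = max_γ H(γ x)`: only finitely many cosets have
`H(γ x) > H(x)∕2`, ★ `finite_setOf_lt_borelHeight`, and `H(γ x)` depends only on the coset `B(F)γ`). [cite: BernsteinLapid2019, §4 (p. 10)] -/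
theorem exists_forall_borelHeight_mul_le (x : (quasiSplit F E c 3).Adelic) :
    ∃ γ₀ : (quasiSplit F E c 3).arithmeticSubgroup, ∀ γ : (quasiSplit F E c 3).arithmeticSubgroup,
      borelHeight ((γ : (quasiSplit F E c 3).Adelic) * x) ≤ borelHeight ((γ₀ : (quasiSplit F E c 3).Adelic) * x) := by
  classical
  set T : ℝ≥0 := borelHeight x / 2 with hT
  have hx0 : 0 < borelHeight x := borelHeight_pos x
  have hT0 : 0 < T := div_pos hx0 two_pos
  have hTx : T < borelHeight x := by rw [hT]; exact NNReal.half_lt_self hx0.ne'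
  set S := {q : Quotient (QuotientGroup.rightRel (arithmeticBorel F E c 3)) |
      T < borelHeight (((q.out : (quasiSplit F E c 3).arithmeticSubgroup) : (quasiSplit F E c 3).Adelic) * x)} with hS
  have hSf : S.Finite := finite_setOf_lt_borelHeight x hT0
  have h1S : Quotient.mk (QuotientGroup.rightRel (arithmeticBorel F E c 3)) 1 ∈ S := by
    show T < _
    rw [borelHeight_out_one_mul]
    exact hTx
  obtain ⟨q₀, hq₀, hmax⟩ := Set.exists_max_image S
    (fun q => borelHeight (((q.out : (quasiSplit F E c 3).arithmeticSubgroup) : (quasiSplit F E c 3).Adelic) * x)) hSf ⟨_, h1S⟩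
  refine ⟨q₀.out, fun γ => ?_⟩
  rw [← borelHeight_out_mk_mul γ x]
  by_cases hγ : Quotient.mk (QuotientGroup.rightRel (arithmeticBorel F E c 3)) γ ∈ S
  · exact hmax _ hγ
  · have hle : borelHeight ((((Quotient.mk (QuotientGroup.rightRel (arithmeticBorel F E c 3)) γ).out :
        (quasiSplit F E c 3).arithmeticSubgroup) : (quasiSplit F E c 3).Adelic) * x) ≤ T := not_lt.1 hγ
    calc _ ≤ T := hle
      _ ≤ borelHeight x := hTx.le
      _ = _ := (borelHeight_out_one_mul x).symm
      _ ≤ _ := hmax _ h1S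

/-- `H(γ x) ≤ w₁(x) := ⨆_{γ' ∈ G(F)} H(γ' x)`. [cite: BernsteinLapid2019, §4 (p. 10)] -/
theorem borelHeight_mul_le_ciSup (γ : (quasiSplit F E c 3).arithmeticSubgroup) (x : (quasiSplit F E c 3).Adelic) :
    borelHeight ((γ : (quasiSplit F E c 3).Adelic) * x) ≤
      ⨆ γ' : (quasiSplit F E c 3).arithmeticSubgroup, borelHeight ((γ' : (quasiSplit F E c 3).Adelic) * x) :=
  le_ciSup (bddAbove_range_borelHeight_mul x) γ

/-- `H(x) ≤ w₁(x)` (`γ = 1`). [cite: BernsteinLapid2019, §4 (p. 10)] -/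
theorem borelHeight_le_ciSup (x : (quasiSplit F E c 3).Adelic) :
    borelHeight x ≤ ⨆ γ' : (quasiSplit F E c 3).arithmeticSubgroup, borelHeight ((γ' : (quasiSplit F E c 3).Adelic) * x) := by
  have h := borelHeight_mul_le_ciSup (1 : (quasiSplit F E c 3).arithmeticSubgroup) x
  rwa [OneMemClass.coe_one, one_mul] at h

/-- **`w₁(x)` is a maximum**: `∃ γ₀ ∈ G(F), H(γ₀ x) = ⨆_γ H(γ x)`. [cite: BernsteinLapid2019, §4 (p. 10)] -/
theorem exists_borelHeight_mul_eq_ciSup (x : (quasiSplit F E c 3).Adelic) :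
    ∃ γ₀ : (quasiSplit F E c 3).arithmeticSubgroup, borelHeight ((γ₀ : (quasiSplit F E c 3).Adelic) * x) =
      ⨆ γ : (quasiSplit F E c 3).arithmeticSubgroup, borelHeight ((γ : (quasiSplit F E c 3).Adelic) * x) := by
  obtain ⟨γ₀, h⟩ := exists_forall_borelHeight_mul_le x
  exact ⟨γ₀, le_antisymm (borelHeight_mul_le_ciSup γ₀ x) (ciSup_le h)⟩

/-- `0 < w₁(x)`. [cite: BernsteinLapid2019, §4 (p. 10)] -/
theorem ciSup_borelHeight_mul_pos (x : (quasiSplit F E c 3).Adelic) :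
    0 < ⨆ γ : (quasiSplit F E c 3).arithmeticSubgroup, borelHeight ((γ : (quasiSplit F E c 3).Adelic) * x) :=
  lt_of_lt_of_le (borelHeight_pos x) (borelHeight_le_ciSup x)

/-- **`w₁` IS `G(F)`-INVARIANT**: `⨆_γ H(γ · γ₁ x) = ⨆_γ H(γ x)` for `γ₁ ∈ G(F)` (reindex by `γ ↦ γ γ₁`); so `w₁` descends to the automorphic quotient.
[cite: BernsteinLapid2019, §4 (p. 10)] -/
theorem ciSup_borelHeight_mul_mul (γ₁ : (quasiSplit F E c 3).arithmeticSubgroup) (x : (quasiSplit F E c 3).Adelic) :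
    (⨆ γ : (quasiSplit F E c 3).arithmeticSubgroup, borelHeight ((γ : (quasiSplit F E c 3).Adelic) * ((γ₁ : (quasiSplit F E c 3).Adelic) * x))) =
      ⨆ γ : (quasiSplit F E c 3).arithmeticSubgroup, borelHeight ((γ : (quasiSplit F E c 3).Adelic) * x) := by
  have h : (fun γ : (quasiSplit F E c 3).arithmeticSubgroup => borelHeight ((γ : (quasiSplit F E c 3).Adelic) * ((γ₁ : (quasiSplit F E c 3).Adelic) * x))) =
      (fun γ : (quasiSplit F E c 3).arithmeticSubgroup => borelHeight ((γ : (quasiSplit F E c 3).Adelic) * x)) ∘ (fun γ => γ * γ₁) := by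
    funext γ
    simp only [Function.comp_apply, Subgroup.coe_mul, mul_assoc]
  rw [h]
  exact (Equiv.mulRight γ₁).surjective.iSup_comp (fun γ : (quasiSplit F E c 3).arithmeticSubgroup => borelHeight ((γ : (quasiSplit F E c 3).Adelic) * x))

/-- **THE COSET COUNT IS `G(F)`-INVARIANT** (one inequality; the other is the same with `γ₁⁻¹`): `#{q ∣ c < H(q̃ · γ₁ y)} ≤ #{q ∣ c < H(q̃ y)}` —
`q ↦ B(F)(q̃ γ₁)` maps the first set injectively into the second (★ `borelHeight_out_mk_mul`). [cite: BernsteinLapid2019, §4 (p. 9)] -/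
theorem ncard_setOf_lt_borelHeight_mul_le (c₀ : ℝ≥0) (γ₁ : (quasiSplit F E c 3).arithmeticSubgroup) (y : (quasiSplit F E c 3).Adelic)
    (hfin : {q : Quotient (QuotientGroup.rightRel (arithmeticBorel F E c 3)) |
        c₀ < borelHeight (((q.out : (quasiSplit F E c 3).arithmeticSubgroup) : (quasiSplit F E c 3).Adelic) * y)}.Finite) :
    {q : Quotient (QuotientGroup.rightRel (arithmeticBorel F E c 3)) |
        c₀ < borelHeight (((q.out : (quasiSplit F E c 3).arithmeticSubgroup) : (quasiSplit F E c 3).Adelic) * ((γ₁ : (quasiSplit F E c 3).Adelic) * y))}.ncard ≤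
      {q : Quotient (QuotientGroup.rightRel (arithmeticBorel F E c 3)) |
        c₀ < borelHeight (((q.out : (quasiSplit F E c 3).arithmeticSubgroup) : (quasiSplit F E c 3).Adelic) * y)}.ncard := by
  classical
  set f : Quotient (QuotientGroup.rightRel (arithmeticBorel F E c 3)) → Quotient (QuotientGroup.rightRel (arithmeticBorel F E c 3)) :=
    fun q => Quotient.mk (QuotientGroup.rightRel (arithmeticBorel F E c 3)) (q.out * γ₁) with hf
  refine Set.ncard_le_ncard_of_injOn f (fun q hq => ?_) (fun q hq q' hq' hqq => ?_) hfin
  · show c₀ < _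
    rw [hf, borelHeight_out_mk_mul, Subgroup.coe_mul, mul_assoc]
    exact hq
  · -- `B(q̃γ₁) = B(q̃'γ₁)` ⟹ `q̃' q̃⁻¹ ∈ B(F)` ⟹ `q = q'`
    have hrel : q'.out * q.out⁻¹ ∈ arithmeticBorel F E c 3 := by
      have h := QuotientGroup.rightRel_apply.1 (Quotient.exact hqq)
      simpa only [_root_.mul_inv_rev, mul_assoc, mul_inv_cancel_left] using h
    rw [← Quotient.out_eq q, ← Quotient.out_eq q']
    exact Quotient.sound (QuotientGroup.rightRel_apply.2 hrel)

/-- **Heights along the lattice move boundedly under a fixed adelic element**: `H(δ y) ≤ H_mat(y⁻¹) · H(δ)` for all `δ, y ∈ G(𝔸)` (`h(e₂δ) = h((e₂δ y) y⁻¹)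
≤ H_mat(y⁻¹) h(e₂δ y)`, ★ `vecHeight_vecMul_le`). [cite: Garrett2018, Thm. 2.2.2 (PDF p. 82)] -/
theorem borelHeight_mul_le_matHeightBound_mul (δ y : (quasiSplit F E c 3).Adelic) :
    borelHeight (δ * y) ≤ matHeightBound E (((adelicVal F E c 3 _ y)⁻¹ : GL (Fin 3) (AdeleRing (𝓞 E) E)) : Matrix (Fin 3) (Fin 3) (AdeleRing (𝓞 E) E)) *
      borelHeight δ := by
  set M := matHeightBound E (((adelicVal F E c 3 _ y)⁻¹ : GL (Fin 3) (AdeleRing (𝓞 E) E)) : Matrix (Fin 3) (Fin 3) (AdeleRing (𝓞 E) E)) with hM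
  have hback : lastRow (δ * y) ᵥ* (((adelicVal F E c 3 _ y)⁻¹ : GL (Fin 3) (AdeleRing (𝓞 E) E)) : Matrix (Fin 3) (Fin 3) (AdeleRing (𝓞 E) E)) = lastRow δ := by
    rw [lastRow_mul, Matrix.vecMul_vecMul, ← Units.val_mul, mul_inv_cancel, Units.val_one, Matrix.vecMul_one]
  have hle : vecHeight E (lastRow δ) ≤ M * vecHeight E (lastRow (δ * y)) := by
    have h := vecHeight_vecMul_le (K := E) (isHeightFinite_lastRow (δ * y))
      (M := (((adelicVal F E c 3 _ y)⁻¹ : GL (Fin 3) (AdeleRing (𝓞 E) E)) : Matrix (Fin 3) (Fin 3) (AdeleRing (𝓞 E) E)))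
      (by rw [hback]; exact isHeightFinite_lastRow δ)
    rwa [hback] at h
  have hδ0 : 0 < vecHeight E (lastRow δ) := vecHeight_lastRow_pos δ
  have hδy0 : 0 < vecHeight E (lastRow (δ * y)) := vecHeight_lastRow_pos (δ * y)
  rw [borelHeight_def, borelHeight_def]
  calc (vecHeight E (lastRow (δ * y)))⁻¹
      = vecHeight E (lastRow δ) * (vecHeight E (lastRow δ))⁻¹ * (vecHeight E (lastRow (δ * y)))⁻¹ := by
        rw [mul_inv_cancel₀ hδ0.ne', one_mul]
    _ ≤ (M * vecHeight E (lastRow (δ * y))) * (vecHeight E (lastRow δ))⁻¹ * (vecHeight E (lastRow (δ * y)))⁻¹ := by gcongr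
    _ = M * (vecHeight E (lastRow δ))⁻¹ * (vecHeight E (lastRow (δ * y)) * (vecHeight E (lastRow (δ * y)))⁻¹) := by ring
    _ = M * (vecHeight E (lastRow δ))⁻¹ := by rw [mul_inv_cancel₀ hδy0.ne', mul_one]

/-! ## §3 `inf H = 0`: the ray elements `a(r) = diag(z_E(r), 1, z_E(r)⁻¹)` -/

/-- **The torus element `a(r) = diag(z_E(r), 1, z_E(r)⁻¹) ∈ T(𝔸_F)`** (`z_E = posRealIdele`; ★ `exists_torusInBorel_ray`) and its HEIGHT LAW `H(a(r) · g) = r^{[E:ℚ]} · H(g)`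
(★ `borelHeight_ray_mul`) — the `N = 3` twin of ★ `exists_torus_posRealIdele_two` (no `c² = 1` needed: the middle entry is `1`). [cite: Borel1963, §5] [cite: Rogawski1990, §2.2 (p. 13)] -/
theorem exists_torus_posRealIdele_three (r : ℝ≥0ˣ) :
    ∃ t : torusInBorel F E c 3,
      adelicVal F E c 3 _ ((t : borelAdelic F E c 3) : (quasiSplit F E c 3).Adelic) =
          glDiagonal 3 (AdeleRing (𝓞 E) E) ![posRealIdele E r, 1, posRealIdele E r⁻¹] ∧
        ∀ g : (quasiSplit F E c 3).Adelic,
          borelHeight (((t : borelAdelic F E c 3) : (quasiSplit F E c 3).Adelic) * g) = ((r : ℝ≥0) ^ Module.finrank ℚ E) * borelHeight g := by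
  obtain ⟨t, ht⟩ := K2E1HeisenbergRadicalConjugationU3.exists_torusInBorel_ray (F := F) (E := E) (c := c) r
  exact ⟨t, ht.symm, fun g => K2E1HeightFunctionU3.borelHeight_ray_mul r ht g⟩

/-- **`inf H = 0` ALONG THE TORUS**: for every `ε > 0` some `t ∈ T(𝔸_F)` has `H(t) < ε` (B–L's use of «`H → 0` on `N(F)∖G(𝔸)`» in Claim 2 at `N = 3`: a constant term
`b · H^{2−z}` bounded near `H = 0` with `Re z > 2` forces `b = 0`). [cite: BernsteinLapid2019, §4 Claim 2 (p. 9)] [cite: Borel1963, §5] -/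
theorem exists_torus_borelHeight_lt {ε : ℝ≥0} (hε : 0 < ε) :
    ∃ t : torusInBorel F E c 3, borelHeight ((t : borelAdelic F E c 3) : (quasiSplit F E c 3).Adelic) < ε := by
  set H₁ : ℝ≥0 := borelHeight (1 : (quasiSplit F E c 3).Adelic) with hH₁def
  have hH₁ : 0 < H₁ := borelHeight_pos _
  set r₀ : ℝ≥0 := min 1 (ε / (2 * H₁)) with hr₀
  have hr₀pos : 0 < r₀ := lt_min one_pos (div_pos hε (mul_pos two_pos hH₁))
  obtain ⟨t, -, hH⟩ := exists_torus_posRealIdele_three (F := F) (E := E) (c := c) (Units.mk0 r₀ hr₀pos.ne')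
  refine ⟨t, ?_⟩
  have h1 := hH 1
  rw [mul_one, Units.val_mk0] at h1
  rw [h1]
  have hd : Module.finrank ℚ E ≠ 0 := Module.finrank_pos.ne'
  calc r₀ ^ Module.finrank ℚ E * H₁ ≤ r₀ * H₁ := by
        gcongr
        exact pow_le_of_le_one bot_le (min_le_left _ _) hd
    _ ≤ ε / (2 * H₁) * H₁ := by gcongr; exact min_le_right _ _
    _ = ε / 2 := by rw [div_mul_eq_mul_div, mul_div_mul_right _ _ hH₁.ne']
    _ < ε := NNReal.half_lt_self hε.ne'

/-- Hence `inf_{G(𝔸)} H = 0`: for every `ε > 0` some `g ∈ G(𝔸)` has `H(g) < ε`. [cite: BernsteinLapid2019, §4 Claim 2 (p. 9)] -/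
theorem exists_borelHeight_lt {ε : ℝ≥0} (hε : 0 < ε) : ∃ g : (quasiSplit F E c 3).Adelic, borelHeight g < ε := by
  obtain ⟨t, ht⟩ := exists_torus_borelHeight_lt (F := F) (E := E) (c := c) hε
  exact ⟨_, ht⟩

end Generic

end Summit.HodgeConjecture.HodgeConjecture.Cruxes.H413.K2E1BLHeightCosetsU3

end
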